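import Summits.AtomisticToContinuum.HydrodynamicLimit.Theorems.InformationPercolationEnginePercolationClosesChaosRevealedDefectFluxStability
import Summits.AtomisticToContinuum.HydrodynamicLimit.Theorems.InformationPercolationEnginePercolationClosesChaosRevealedDefectReduction
import HarnessLib

/-!
# The pair-law term and the per-collision atoms of the oscillation lemma `DefectOscDomination` (stub S8 of the line
`equilibrium-forecast-chain-rule`, crux `InformationPercolationEngine.PercolationClosesChaos`, stmt-AtomisticToContinuum-15178)

Support file (`--supports stmt-AtomisticToContinuum-15178`) of the registered stub `stub_revealedDefectStability` (worker W6 of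
lead c3). Step 4 of the paper proof of `DefectOscDomination` (`…RevealedDefectReduction.lean`, audit `S8.audit.md` §B), in Lean:
for two initial data whose step-start configurations have the same cells sphere by sphere (`startCell` agrees — two points of one
revealed atom share `hist k`) and velocities within `β` of each other (same velocity bins, `β = √3 b`), and a `TamePair s₀ E₀` pair
of start-cell populations `(q, q')` in the first datum, the flux-weighted pair averages `pairPair Ψ / pairPair 1 (q, q')` differ by
at most `m + 4C(E₀/V + E₀√E₀/V²)/s₀ + 10 C β/s₀` (`abs_pairRatio_sub_le`, registered headline; `m` a modulus of `Ψ` at scale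
`β` on speeds `≤ V`, supplied by `exists_modulus_markTest` = uniform continuity of `Ψ` on `S² × B̄_R × B̄_R`). It is the abstract
flux-ratio stability `abs_fluxRatio_sub_le` of `…RevealedDefectFluxStability.lean` read through `pairPair_eq_sum_filter`
(`pairPair` as a sum over the ordered pairs of distinct labels with the given start cells; the diagonal of `P × Q` carries no
relative speed). Also the atoms of step 3 (`norm_unit_sub_unit_le_V3`: `‖u/‖u‖ − u'/‖u'‖‖ ≤ 2‖u − u'‖/‖u‖`; `reflectVel_kick`;
`markOf_fst_eq_kick`: on a good orbit the impact direction IS the unit kick `ω = (v⁺ − v⁻)/‖v⁺ − v⁻‖` with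
`‖v⁺ − v⁻‖ = |⟨v⁻ − w⁻, ω⟩|`, the pair being incoming; `norm_unitKick_sub_le`: kicks `g ≤ ‖κ‖`, `‖κ − κ'‖ ≤ 2β` give
`‖ω − ω'‖ ≤ 4β/g`; `abs_markTest_sub_le`: step 3 PER COLLISION — same ordered pair, pre-velocities `β`-close, kicks `2β`-close,
the first non-grazing with slow participants ⇒ `|Ψ(mark) − Ψ(mark')| ≤ m`, `m` the modulus at scale `4β/g ∨ β` on `S² × B̄_{V+1}²`;
`markOf_swap`: the mark of the swapped ordered pair is `(−ω, w⁻, v⁻)`, so the second-slot case reduces to the first) and the truncation algebra of step 6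
(`min_le_max_mul_min_of_osc`: `η < osc ≤ 4C·rough/owned + η/2 ⇒ min(owned,T) ≤ max(8C/η,1)·min(rough,T)`). What is NOT
here: the collision-level dictionary of a revealed atom (worker W3) and the assembly of `DefectOscDomination` from steps 1–6.
-/

noncomputable section

open MeasureTheory Set Filter Topology
open scoped ENNReal BigOperators Classical
open Literature.Analysis.FluidPDE Literature.MathematicalPhysics.KineticTheory
open Literature.MathematicalPhysics.KineticTheory.VelocityBlindPlacement

namespace Summit.AtomisticToContinuum.HydrodynamicLimit.Theorems.EquilibriumForecastLine

/-! ## Kick geometry and the modulus of continuity of a mark test -/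

/-- Kick geometry: `‖u/‖u‖ − u'/‖u'‖‖ ≤ 2 ‖u − u'‖ / ‖u‖` for `u ≠ 0`. [folklore] -/
theorem norm_unit_sub_unit_le_V3 {u u' : V3} (hu : u ≠ 0) :
    ‖‖u‖⁻¹ • u - ‖u'‖⁻¹ • u'‖ ≤ 2 * ‖u - u'‖ / ‖u‖ := by
  have hu0 : 0 < ‖u‖ := norm_pos_iff.2 hu
  by_cases hu' : u' = 0
  · subst hu'
    rw [norm_zero, inv_zero, zero_smul, sub_zero, norm_smul, norm_inv, norm_norm, inv_mul_cancel₀ hu0.ne', sub_zero,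
      le_div_iff₀ hu0]
    linarith
  have hu'0 : 0 < ‖u'‖ := norm_pos_iff.2 hu'
  calc ‖‖u‖⁻¹ • u - ‖u'‖⁻¹ • u'‖
      = ‖(‖u‖⁻¹ • u - ‖u‖⁻¹ • u') + (‖u‖⁻¹ • u' - ‖u'‖⁻¹ • u')‖ := by congr 1; abel
    _ ≤ ‖‖u‖⁻¹ • u - ‖u‖⁻¹ • u'‖ + ‖‖u‖⁻¹ • u' - ‖u'‖⁻¹ • u'‖ := norm_add_le _ _
    _ = ‖u - u'‖ / ‖u‖ + |‖u‖⁻¹ - ‖u'‖⁻¹| * ‖u'‖ := by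
        rw [← smul_sub, norm_smul, norm_inv, norm_norm, ← sub_smul, norm_smul, Real.norm_eq_abs]
        ring
    _ = ‖u - u'‖ / ‖u‖ + |‖u'‖ - ‖u‖| / ‖u‖ := by
        congr 1
        rw [inv_sub_inv hu0.ne' hu'0.ne', abs_div, abs_of_pos (mul_pos hu0 hu'0)]
        field_simp
    _ ≤ ‖u - u'‖ / ‖u‖ + ‖u - u'‖ / ‖u‖ := by
        gcongr
        rw [abs_sub_comm]
        exact abs_norm_sub_norm_le u u'
    _ = 2 * ‖u - u'‖ / ‖u‖ := by ring

/-- **Modulus of continuity of a continuous mark test on `S² × B̄_R × B̄_R`** (uniform continuity on a compact set), in the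
form the oscillation lemma consumes. [folklore] -/
theorem exists_modulus_markTest {Ψ : V3 × V3 × V3 → ℝ} (hΨc : Continuous Ψ) (R : ℝ) {ε : ℝ} (hε : 0 < ε) :
    ∃ t : ℝ, 0 < t ∧ ∀ (ω ω' v w v' w' : V3), ‖ω‖ = 1 → ‖ω'‖ = 1 → ‖v‖ ≤ R → ‖w‖ ≤ R → ‖v'‖ ≤ R → ‖w'‖ ≤ R →
      ‖ω - ω'‖ ≤ t → ‖v - v'‖ ≤ t → ‖w - w'‖ ≤ t → |Ψ (ω, v, w) - Ψ (ω', v', w')| ≤ ε := by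
  set K : Set (V3 × V3 × V3) := Metric.sphere (0 : V3) 1 ×ˢ (Metric.closedBall (0 : V3) R ×ˢ Metric.closedBall (0 : V3) R)
  have hK : IsCompact K := (isCompact_sphere 0 1).prod ((isCompact_closedBall 0 R).prod (isCompact_closedBall 0 R))
  have hU : UniformContinuousOn Ψ K := hK.uniformContinuousOn_of_continuous hΨc.continuousOn
  obtain ⟨δ, hδ, hUδ⟩ := Metric.uniformContinuousOn_iff.1 hU ε hε
  refine ⟨δ / 2, by positivity, ?_⟩
  intro ω ω' v w v' w' hω hω' hv hw hv' hw' h1 h2 h3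
  have hm : (ω, v, w) ∈ K := by
    simp only [K, Set.mem_prod, mem_sphere_zero_iff_norm, Metric.mem_closedBall, dist_zero_right]
    exact ⟨hω, hv, hw⟩
  have hm' : (ω', v', w') ∈ K := by
    simp only [K, Set.mem_prod, mem_sphere_zero_iff_norm, Metric.mem_closedBall, dist_zero_right]
    exact ⟨hω', hv', hw'⟩
  have hd : dist (ω, v, w) (ω', v', w') < δ := by
    rw [Prod.dist_eq, Prod.dist_eq, dist_eq_norm, dist_eq_norm, dist_eq_norm]
    refine max_lt (by linarith) (max_lt (by linarith) (by linarith))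
  have := hUδ _ hm _ hm' hd
  rw [Real.dist_eq] at this
  exact this.le

/-! ## The impact direction is the unit kick (step 3) -/

/-- Reflection algebra: for `n ≠ 0` and `(v⁻, w⁻) = reflectVel n (v⁺, w⁺)`, the kick of the first particle is
`v⁺ − v⁻ = (⟪v⁺ − w⁺, n⟫/‖n‖²) n` and the normal relative velocity flips: `⟪v⁻ − w⁻, n⟫ = −⟪v⁺ − w⁺, n⟫`. [folklore] -/
theorem reflectVel_kick (n : V3) (p : V3 × V3) :
    p.1 - (reflectVel n p).1 = (inner ℝ (p.1 - p.2) n / ‖n‖ ^ 2) • n ∧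
      inner ℝ ((reflectVel n p).1 - (reflectVel n p).2) n = -inner ℝ (p.1 - p.2) n := by
  by_cases hn : n = 0
  · subst hn; simp [reflectVel]
  have hn2 : ‖n‖ ^ 2 ≠ 0 := pow_ne_zero 2 (norm_ne_zero_iff.2 hn)
  constructor
  · simp only [reflectVel]
    abel
  · simp only [reflectVel]
    have h1 : (p.1 - (inner ℝ (p.1 - p.2) n / ‖n‖ ^ 2) • n - (p.2 + (inner ℝ (p.1 - p.2) n / ‖n‖ ^ 2) • n)) =
        (p.1 - p.2) - (2 * (inner ℝ (p.1 - p.2) n / ‖n‖ ^ 2)) • n := by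
      rw [mul_smul, two_smul]; abel
    rw [h1, inner_sub_left, inner_smul_left, real_inner_self_eq_norm_sq]
    simp only [conj_trivial]
    field_simp
    ring

/-- **The impact direction is the unit kick (step 3 of the oscillation lemma).** At a collision triple of a good orbit, with
`μ = markOf … w i j = (ω, v⁻, w⁻)` read off the post-collisional configuration `w = Φ_t z` and `κ = v⁺ − v⁻` the kick of the
first particle: `ω = κ/‖κ‖` and `‖κ‖ = |⟨v⁻ − w⁻, ω⟩|` (the pre-collisional pair is incoming, `inner_sepVec_preVel_neg`). Hence
off `g`-grazing collisions the kick resolves `ω` (`norm_unit_sub_unit_le_V3`). [folklore] -/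
theorem markOf_fst_eq_kick {σ : ℝ} {N : ℕ} (Φ : Flow σ N) {z : Phase N} (hz : z ∈ Φ.good) (hσ : 0 < σ) {t : ℝ}
    {i j : Fin (N + 1)} (hp : (i, j) ∈ contactPairs G3 (hsDiameter σ N) (Φ.flow t z)) :
    (markOf N (hsDiameter σ N) (Φ.flow t z) i j).1 =
        ‖((Φ.flow t z) i).2 - (markOf N (hsDiameter σ N) (Φ.flow t z) i j).2.1‖⁻¹ •
          (((Φ.flow t z) i).2 - (markOf N (hsDiameter σ N) (Φ.flow t z) i j).2.1) ∧
      ‖((Φ.flow t z) i).2 - (markOf N (hsDiameter σ N) (Φ.flow t z) i j).2.1‖ =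
        |inner ℝ ((markOf N (hsDiameter σ N) (Φ.flow t z) i j).2.1 - (markOf N (hsDiameter σ N) (Φ.flow t z) i j).2.2)
          (markOf N (hsDiameter σ N) (Φ.flow t z) i j).1| := by
  set w := Φ.flow t z with hw
  set ε := hsDiameter σ N with hεdef
  have hε : 0 < ε := hsDiameter_pos hσ N
  set n := G3.sepVec (w i).1 (w j).1 with hndef
  obtain ⟨hij, hc⟩ := mem_contactPairs.1 hp
  have hnorm : ‖n‖ = ε := (mem_contactSet.1 hc).2
  have hn0 : n ≠ 0 := by rw [← norm_ne_zero_iff, hnorm]; exact hε.ne'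
  -- the mark
  have hμ1 : (markOf N ε w i j).1 = ε⁻¹ • n := rfl
  have hμ2 : (markOf N ε w i j).2 = reflectVel n ((w i).2, (w j).2) := rfl
  obtain ⟨hkick, hflip⟩ := reflectVel_kick n ((w i).2, (w j).2)
  -- incoming
  have hin : inner ℝ n ((markOf N ε w i j).2.1 - (markOf N ε w i j).2.2) < 0 := by
    have h := (Φ.isTrajectory z hz).inner_sepVec_preVel_neg (t := t) hp
    rw [HardSphereCollisionRecord.ofConfig_preVel] at h
    exact h
  -- unit impact direction
  have hω : ‖(markOf N ε w i j).1‖ = 1 := by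
    rw [hμ1, norm_smul, norm_inv, Real.norm_of_nonneg hε.le, hnorm, inv_mul_cancel₀ hε.ne']
  -- the kick along `ω`
  set s := inner ℝ ((w i).2 - (w j).2) (markOf N ε w i j).1 with hsdef
  have hκ : (w i).2 - (markOf N ε w i j).2.1 = s • (markOf N ε w i j).1 := by
    rw [hμ2, hkick, hsdef, hμ1, inner_smul_right, smul_smul, hnorm]
    congr 1
    field_simp
  have hinner : inner ℝ ((markOf N ε w i j).2.1 - (markOf N ε w i j).2.2) (markOf N ε w i j).1 = -s := by
    rw [hμ2, hsdef, hμ1, inner_smul_right, inner_smul_right, hflip]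
    ring
  have hs : 0 < s := by
    have h2 : inner ℝ ((markOf N ε w i j).2.1 - (markOf N ε w i j).2.2) (markOf N ε w i j).1 < 0 := by
      rw [hμ1, inner_smul_right, real_inner_comm]
      exact mul_neg_of_pos_of_neg (inv_pos.2 hε) hin
    linarith [hinner ▸ h2]
  have hnormκ : ‖(w i).2 - (markOf N ε w i j).2.1‖ = s := by
    rw [hκ, norm_smul, hω, mul_one, Real.norm_of_nonneg hs.le]
  refine ⟨?_, ?_⟩
  · rw [hnormκ, hκ, smul_smul, inv_mul_cancel₀ hs.ne', one_smul]
  · rw [hnormκ, hinner, abs_neg, abs_of_pos hs]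

/-- **Resolution of the impact direction by the kick**: two kicks `κ, κ'` with `g ≤ ‖κ‖` and `‖κ − κ'‖ ≤ 2β` have unit vectors
within `4β/g` (with `markOf_fst_eq_kick`: off `g`-grazing collisions the binned own pre/post velocities pin `ω` to `4√3 b/g`). [folklore] -/
theorem norm_unitKick_sub_le {κ κ' : V3} {g β : ℝ} (hg : 0 < g) (hκ : g ≤ ‖κ‖) (hκκ' : ‖κ - κ'‖ ≤ 2 * β) :
    ‖‖κ‖⁻¹ • κ - ‖κ'‖⁻¹ • κ'‖ ≤ 4 * β / g := by
  have hκ0 : κ ≠ 0 := by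
    rw [← norm_ne_zero_iff]
    exact (hg.trans_le hκ).ne'
  have hκpos : 0 < ‖κ‖ := hg.trans_le hκ
  calc ‖‖κ‖⁻¹ • κ - ‖κ'‖⁻¹ • κ'‖ ≤ 2 * ‖κ - κ'‖ / ‖κ‖ := norm_unit_sub_unit_le_V3 hκ0
    _ ≤ 2 * (2 * β) / g := by
        rw [div_le_div_iff₀ hκpos hg]
        have h0 : 0 ≤ 2 * β := (norm_nonneg _).trans hκκ'
        nlinarith [mul_le_mul_of_nonneg_left hκκ' (by norm_num : (0 : ℝ) ≤ 2), mul_le_mul_of_nonneg_left hκ h0]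
    _ = 4 * β / g := by ring

/-- **Step 3 of the oscillation lemma, per collision**: two collision triples of good orbits with the same ordered pair `(i, j)`,
pre-collisional velocities within `β` and kicks within `2β` of each other (same velocity bins of `v⁻, v⁺, w⁻`), the first one
non-`g`-grazing with participants of speed `≤ V`, read the mark test `Ψ` within its modulus `m` on `S² × B̄_{V+1}²` at scale
`s ≥ max(4β/g, β)` (`β ≤ 1`). [folklore] -/
theorem abs_markTest_sub_le {σ : ℝ} {N : ℕ} (Φ : Flow σ N) {z z' : Phase N} (hz : z ∈ Φ.good) (hz' : z' ∈ Φ.good)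
    (hσ : 0 < σ) {t t' : ℝ} {i j : Fin (N + 1)} (hp : (i, j) ∈ contactPairs G3 (hsDiameter σ N) (Φ.flow t z))
    (hp' : (i, j) ∈ contactPairs G3 (hsDiameter σ N) (Φ.flow t' z')) (Ψ : V3 × V3 × V3 → ℝ) {V g β s m : ℝ}
    (hg : 0 < g) (hβ1 : β ≤ 1) (hs4 : 4 * β / g ≤ s) (hsβ : β ≤ s)
    (hgraz : g ≤ |inner ℝ ((markOf N (hsDiameter σ N) (Φ.flow t z) i j).2.1 - (markOf N (hsDiameter σ N) (Φ.flow t z) i j).2.2)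
      (markOf N (hsDiameter σ N) (Φ.flow t z) i j).1|)
    (hvV : ‖(markOf N (hsDiameter σ N) (Φ.flow t z) i j).2.1‖ ≤ V) (hwV : ‖(markOf N (hsDiameter σ N) (Φ.flow t z) i j).2.2‖ ≤ V)
    (hv : ‖(markOf N (hsDiameter σ N) (Φ.flow t z) i j).2.1 - (markOf N (hsDiameter σ N) (Φ.flow t' z') i j).2.1‖ ≤ β)
    (hw : ‖(markOf N (hsDiameter σ N) (Φ.flow t z) i j).2.2 - (markOf N (hsDiameter σ N) (Φ.flow t' z') i j).2.2‖ ≤ β)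
    (hkick : ‖(((Φ.flow t z) i).2 - (markOf N (hsDiameter σ N) (Φ.flow t z) i j).2.1) -
        (((Φ.flow t' z') i).2 - (markOf N (hsDiameter σ N) (Φ.flow t' z') i j).2.1)‖ ≤ 2 * β)
    (hmod : ∀ (ω ω' a b a' b' : V3), ‖ω‖ = 1 → ‖ω'‖ = 1 → ‖a‖ ≤ V + 1 → ‖b‖ ≤ V + 1 → ‖a'‖ ≤ V + 1 → ‖b'‖ ≤ V + 1 →
      ‖ω - ω'‖ ≤ s → ‖a - a'‖ ≤ s → ‖b - b'‖ ≤ s → |Ψ (ω, a, b) - Ψ (ω', a', b')| ≤ m) :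
    |Ψ (markOf N (hsDiameter σ N) (Φ.flow t z) i j) - Ψ (markOf N (hsDiameter σ N) (Φ.flow t' z') i j)| ≤ m := by
  set μ := markOf N (hsDiameter σ N) (Φ.flow t z) i j with hμ
  set μ' := markOf N (hsDiameter σ N) (Φ.flow t' z') i j with hμ'
  obtain ⟨hω, hnκ⟩ := markOf_fst_eq_kick Φ hz hσ hp
  obtain ⟨hω', hnκ'⟩ := markOf_fst_eq_kick Φ hz' hσ hp'
  set κ := ((Φ.flow t z) i).2 - μ.2.1 with hκdef
  set κ' := ((Φ.flow t' z') i).2 - μ'.2.1 with hκ'def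
  -- unit impact directions at contact
  have hε : 0 < hsDiameter σ N := hsDiameter_pos hσ N
  have hunit : ∀ {w : Phase N}, (i, j) ∈ contactPairs G3 (hsDiameter σ N) w → ‖(markOf N (hsDiameter σ N) w i j).1‖ = 1 := by
    intro w hw
    have hc := (mem_contactPairs.1 hw).2
    have hnorm : ‖G3.sepVec (w i).1 (w j).1‖ = hsDiameter σ N := (mem_contactSet.1 hc).2
    show ‖(hsDiameter σ N)⁻¹ • G3.sepVec (w i).1 (w j).1‖ = 1
    rw [norm_smul, norm_inv, Real.norm_of_nonneg hε.le, hnorm, inv_mul_cancel₀ hε.ne']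
  have h1 : ‖μ.1‖ = 1 := hunit hp
  have h1' : ‖μ'.1‖ = 1 := hunit hp'
  -- the kick resolves the impact direction
  have hgκ : g ≤ ‖κ‖ := by rw [hκdef, hnκ]; exact hgraz
  have hωω' : ‖μ.1 - μ'.1‖ ≤ s := by
    rw [hω, hω']
    exact (norm_unitKick_sub_le hg hgκ hkick).trans hs4
  -- speeds
  have hv' : ‖μ'.2.1‖ ≤ V + 1 := by
    have := norm_sub_norm_le μ'.2.1 μ.2.1
    rw [norm_sub_rev] at hv
    linarith
  have hw' : ‖μ'.2.2‖ ≤ V + 1 := by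
    have := norm_sub_norm_le μ'.2.2 μ.2.2
    rw [norm_sub_rev] at hw
    linarith
  have key := hmod μ.1 μ'.1 μ.2.1 μ.2.2 μ'.2.1 μ'.2.2 h1 h1' (by linarith) (by linarith) hv' hw' hωω' (hv.trans hsβ)
    (hw.trans hsβ)
  simpa only [Prod.mk.eta] using key

/-- The reflection law is even in the normal and swaps with the pair: `reflectVel (−n) (w, v) = ((reflectVel n (v, w)).2,
(reflectVel n (v, w)).1)`. [folklore] -/
theorem reflectVel_neg_swap (n v w : V3) :
    reflectVel (-n) (w, v) = ((reflectVel n (v, w)).2, (reflectVel n (v, w)).1) := by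
  simp only [reflectVel, inner_neg_right, norm_neg, smul_neg, Prod.mk.injEq]
  constructor
  · rw [← inner_neg_left, neg_sub, sub_neg_eq_add]
  · rw [← inner_neg_left, neg_sub, ← sub_eq_add_neg]

/-- **The mark of the swapped pair** at a contact of the regular torus geometry (`σ < 1/2`): impact direction negated,
pre-collisional velocities exchanged — `markOf w j i = (−ω, w⁻, v⁻)` for `markOf w i j = (ω, v⁻, w⁻)`. [folklore] -/
theorem markOf_swap {σ : ℝ} {N : ℕ} (hσ : 0 < σ) (hσ2 : σ < 2⁻¹) {w : Phase N} {i j : Fin (N + 1)}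
    (hp : (i, j) ∈ contactPairs G3 (hsDiameter σ N) w) :
    markOf N (hsDiameter σ N) w j i =
      (-(markOf N (hsDiameter σ N) w i j).1,
        ((markOf N (hsDiameter σ N) w i j).2.2, (markOf N (hsDiameter σ N) w i j).2.1)) := by
  have hε : hsDiameter σ N < 2⁻¹ := (hsDiameter_le hσ.le N).trans_lt hσ2
  have hG := Torus.isHardSphereRegular_geometry (d := Fin 3) hε
  have hc := (mem_contactPairs.1 hp).2
  have hnorm : ‖G3.sepVec (w i).1 (w j).1‖ = hsDiameter σ N := (mem_contactSet.1 hc).2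
  have hswap : G3.sepVec (w j).1 (w i).1 = -G3.sepVec (w i).1 (w j).1 := hG.sepVec_comm _ _ hnorm.le
  unfold markOf
  rw [hswap, smul_neg, reflectVel_neg_swap]

/-! ## The pair-law term of the oscillation lemma -/

section PairLaw

variable {σ : ℝ} {N : ℕ} (Φ : Flow σ N)

/-- `pairPair Ξ` as a sum over the finite set of ordered pairs of distinct labels with start cells `(q, q')`. [folklore] -/
theorem pairPair_eq_sum_filter (Ξ : V3 × V3 × V3 → ℝ) (c : ℝ) (k : ℕ) (q q' : Cell) (z : Phase N) :
    pairPair Ξ c σ N Φ k q q' z = (cellCount c σ N ^ 2)⁻¹ *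
      ∑ p ∈ (Finset.univ.filter fun p : Fin (N + 1) × Fin (N + 1) =>
          p.1 ≠ p.2 ∧ startCell c σ N Φ k z p.1 = q ∧ startCell c σ N Φ k z p.2 = q'),
        fluxAvg Ξ ((Φ.flow ((k : ℝ) * stepLen c σ N) z) p.1).2 ((Φ.flow ((k : ℝ) * stepLen c σ N) z) p.2).2 := by
  unfold pairPair startCell
  congr 1
  rw [Finset.sum_filter, ← Finset.univ_product_univ, Finset.sum_product]

end PairLaw

/-- **Registered headline `abs_pairRatio_sub_le` — the pair-law term of the oscillation lemma**: for two initial data whose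
configurations at the step start have the SAME cells and velocities within `β` of each other, sphere by sphere (two points of
one revealed atom: same `hist k`), and a `(s₀, E₀)`-tame pair of start-cell populations `(q, q')` in the first, the flux-weighted
pair averages `pairPair Ψ / pairPair 1 (q, q')` differ by at most `m + 4C(E₀/V + E₀√E₀/V²)/s₀ + 10 C β/s₀`, where `m` is a
modulus of `Ψ` at scale `β` on speeds `≤ V`. [folklore] -/
theorem abs_pairRatio_sub_le : ∀ {σ : ℝ} {N : ℕ} (Φ : Flow σ N) {Ψ : V3 × V3 × V3 → ℝ}, Continuous Ψ → ∀ {C : ℝ}, (∀ p, |Ψ p| ≤ C) → ∀ {c : ℝ}, 0 < c → 0 < σ → ∀ (k : ℕ) (q q' : Cell) {z z' : Phase N}, (∀ i, startCell c σ N Φ k z' i = startCell c σ N Φ k z i) → ∀ {β : ℝ}, 0 ≤ β → (∀ i, ‖((Φ.flow ((k : ℝ) * stepLen c σ N) z') i).2 - ((Φ.flow ((k : ℝ) * stepLen c σ N) z) i).2‖ ≤ β) → ∀ {s₀ E₀ : ℝ}, 0 < s₀ → 0 ≤ E₀ → TamePair s₀ E₀ (Φ.flow ((k : ℝ) * stepLen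 c σ N) z) (pop c σ N (Φ.flow ((k : ℝ) * stepLen c σ N) z) q) (pop c σ N (Φ.flow ((k : ℝ) * stepLen c σ N) z) q') → ∀ {V m : ℝ}, 0 < V → 0 ≤ m → (∀ (ω : Metric.sphere (0 : V3) 1) (a b a' b' : V3), ‖a‖ ≤ V → ‖b‖ ≤ V → ‖a' - a‖ ≤ β → ‖b' - b‖ ≤ β → |Ψ ((ω : V3), a, b) - Ψ ((ω : V3), a', b')| ≤ m) → |pairPair Ψ c σ N Φ k q q' z / pairPair (fun _ => 1) c σ N Φ k q q' z - pairPair Ψ c σ N Φ k q q' z' / pairPair (fun _ => 1) c σ N Φ k q q' z'| ≤ m + 4 * C * (E₀ / V + E₀ * Real.sqrt E₀ / V ^ 2) / s₀ + 10 * C * β / s₀ := by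
  intro σ N Φ Ψ hΨc C hΨ c hc hσ k q q' z z' hcell β hβ hvel s₀ E₀ hs₀ hE0 htame V m hV hm hmod
  obtain ⟨hcold, hP, hQ⟩ := htame
  set w := Φ.flow ((k : ℝ) * stepLen c σ N) z with hw
  set w' := Φ.flow ((k : ℝ) * stepLen c σ N) z' with hw'
  set P := pop c σ N w q with hPdef
  set Q := pop c σ N w q' with hQdef
  set S := Finset.univ.filter fun p : Fin (N + 1) × Fin (N + 1) =>
      p.1 ≠ p.2 ∧ startCell c σ N Φ k z p.1 = q ∧ startCell c σ N Φ k z p.2 = q' with hSdef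
  have hS' : (Finset.univ.filter fun p : Fin (N + 1) × Fin (N + 1) =>
      p.1 ≠ p.2 ∧ startCell c σ N Φ k z' p.1 = q ∧ startCell c σ N Φ k z' p.2 = q') = S := by
    simp only [hSdef, hcell]
  have hn : (cellCount c σ N ^ 2)⁻¹ ≠ 0 := inv_ne_zero (pow_ne_zero 2 (cellCount_pos hc hσ N).ne')
  -- the four `pairPair`s as sums over `S`, and the ratios without the normalisation
  have e1 := pairPair_eq_sum_filter Φ Ψ c k q q' z
  have e2 := pairPair_eq_sum_filter Φ (fun _ => 1) c k q q' z
  have e3 := pairPair_eq_sum_filter Φ Ψ c k q q' z'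
  have e4 := pairPair_eq_sum_filter Φ (fun _ => 1) c k q q' z'
  rw [hS'] at e3 e4
  rw [e1, e2, e3, e4, mul_div_mul_left _ _ hn, mul_div_mul_left _ _ hn]
  -- the abstract lemma
  have hS : S ⊆ P ×ˢ Q := by
    intro p hp
    simp only [hSdef, Finset.mem_filter, Finset.mem_univ, true_and] at hp
    simp only [Finset.mem_product, hPdef, hQdef, pop, Finset.mem_filter, Finset.mem_univ, true_and]
    exact ⟨hp.2.1, hp.2.2⟩
  have hcold' : s₀ * ((P.card : ℝ) * Q.card) ≤ ∑ p ∈ S, ‖(w p.1).2 - (w p.2).2‖ := by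
    refine hcold.trans (le_of_eq ?_)
    -- the diagonal terms vanish, and the off-diagonal part of `P × Q` is `S`
    have hsplit := Finset.sum_filter_add_sum_filter_not (P ×ˢ Q) (fun p : Fin (N + 1) × Fin (N + 1) => p.1 ≠ p.2)
      (fun p => ‖(w p.1).2 - (w p.2).2‖)
    have hdiag : ∑ p ∈ (P ×ˢ Q).filter (fun p : Fin (N + 1) × Fin (N + 1) => ¬ p.1 ≠ p.2), ‖(w p.1).2 - (w p.2).2‖ = 0 := by
      refine Finset.sum_eq_zero fun p hp => ?_
      have h : p.1 = p.2 := by simpa using (Finset.mem_filter.1 hp).2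
      rw [h, sub_self, norm_zero]
    have hfilt : (P ×ˢ Q).filter (fun p : Fin (N + 1) × Fin (N + 1) => p.1 ≠ p.2) = S := by
      ext p
      simp only [Finset.mem_filter, Finset.mem_product, hPdef, hQdef, pop, Finset.mem_univ, true_and, hSdef, startCell]
      tauto
    rw [← hsplit, hdiag, add_zero, hfilt]
  exact abs_fluxRatio_sub_le P Q S hS (fun i => (w i).2) (fun i => (w' i).2) hβ hvel hs₀ hE0 hcold' hP hQ hΨc hΨ hV hm
    hmod


/-! ## The truncation algebra of the oscillation lemma (step 6) -/

/-- **Truncation algebra of the oscillation lemma**: if the oscillation exceeds `η` but is at most `4C · rough/owned + η/2`,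
then `min(owned, T) ≤ max(8C/η, 1) · min(rough, T)`. [folklore] -/
theorem min_le_max_mul_min_of_osc {oc rough T C η osc : ℝ} (hoc : 0 < oc) (hr : 0 ≤ rough) (hT : 0 ≤ T) (hη : 0 < η)
    (hosc : η < osc) (hbound : osc ≤ 4 * C * rough / oc + η / 2) :
    min oc T ≤ max (8 * C / η) 1 * min rough T := by
  set M := max (8 * C / η) 1 with hM
  have hM1 : 1 ≤ M := le_max_right _ _
  have hM0 : 0 ≤ M := zero_le_one.trans hM1
  have h1 : η / 2 < 4 * C * rough / oc := by linarith
  have h2 : oc * (η / 2) < 4 * C * rough := by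
    have := (lt_div_iff₀ hoc).1 h1
    linarith
  have h3 : oc ≤ M * rough := by
    have h4 : oc < 8 * C / η * rough := by
      rw [div_mul_eq_mul_div, lt_div_iff₀ hη]
      nlinarith
    exact h4.le.trans (mul_le_mul_of_nonneg_right (le_max_left _ _) hr)
  have h5 : T ≤ M * T := le_mul_of_one_le_left hT hM1
  rw [mul_min_of_nonneg _ _ hM0]
  exact min_le_min h3 h5


end Summit.AtomisticToContinuum.HydrodynamicLimit.Theorems.EquilibriumForecastLine

end
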